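import Literature.Analysis.FluidPDE.BurgersVortexPeakSpeed
import Summits.NavierStokesRegularity.FluidComputer.PalasekTowerFaceNumbers
import Summits.NavierStokesRegularity.FluidComputer.PalasekTowerRegisterGlobalFirstHitting

/-!
# The ONE-SHOT BUDGET IDENTITY of a Burgers child: strain and seed cannot both pre-exist at the anchor
# (crux `EpisodeBase`, stmt-NavierStokesRegularity-19179; crux idea `orthogonal-seed-contact-strain` (1))

Cell `ns-blowup`, seat `ns-palasek-19179-p2` (g3; holder of record of the crux `EpisodeBase` = `EpisodeBaseG` of the
route `PalasekTowerBreakdown`, item stmt-NavierStokesRegularity-19179, line `slot` v5). Kernel form of item (1)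
«BUDGET IDENTITY (why the strain cannot pre-exist)» of the crux idea card `Cruxes/EpisodeBase/Ideas/orthogonal-seed-
contact-strain.md` (lens `profile`; holder read 19179 evidence #54; mechcritic-2 verdict #58, USE-1: «land it as a
by-name design-class lemma»). LABEL: MODEL-side register arithmetic on the EXACT steady Burgers vortex
`burgersVortex γ ν Γ = axisymmetricStrain γ + burgersVortexSwirl γ ν Γ` (Literature `BurgersVortex*`): certified
numbers about one explicit infinite-energy field, then a comparison with the register's level-0 anchor.
WHAT THIS IS NOT: not Navier–Stokes evidence — nothing about any finite-energy flow, any registered stage's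
dynamics, `FirstEpisodeD`, `RungG 1` or blow-up; the Burgers vortex is the MODEL of a «child tube sitting in a
coherent strain», and §4 only says that a registered stage's `τ₀`-slice cannot COINCIDE with such a model at one
explicit point.

## The identity (card (1), re-derived exactly)

Probe point `P = (2δ, 0, 0)`, `δ = (ν/γ)^{1/2}` (`twoCorePoint`). There the strain part is radial with speed `γδ`
(`‖U_s(P)‖² = γν`), the swirl is azimuthal with speed `(1 − e^{−1})|Γ|(γ/ν)^{1/2}/(4π)` (the tree's
`norm_burgersVortexSwirl_two_coreRadius`), and the two are orthogonal, so

  `‖u(P)‖² = γν + (1 − e^{−1})² Γ² (γ/ν)/(16π²) ≥ 2·(γν)^{1/2}·(1 − e^{−1})|Γ|(γ/ν)^{1/2}/(4π) = (1 − e^{−1}) γ|Γ|/(2π)`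

(AM–GM; `oneShot_norm_sq_ge`). On the axis `‖Du(0)‖ ≤ γ + γ|Γ|/(8πν)` (the tree's sharp gradient bound
`norm_fderiv_burgersVortex_le_sharp`: strain rate plus core rotation rate), so an axis-gradient floor
`A ≤ ‖Du(0)‖` forces `γ|Γ| ≥ 8πν(A − γ)` and hence

  `‖u(P)‖² ≥ 4(1 − e^{−1}) ν (A − γ) ≥ (316/125) ν (A − γ)`    (`oneShot_norm_sq_ge_of_axisGradient`),

i.e. `‖u(P)‖ ≥ 1.59 (ν(A − γ))^{1/2}` — the card's `1.60 √A` with the strain's own share `γ` of the gradient kept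
(the card reads the gradient floor through the rotation rate alone). REGISTER READING (wide rates, `ν = 1`,
`oneShot_speed_gt_Y_zero`): with the level-1 strain floor `A = A₁ ∈ (1238360, 1238361)` and any host strain
`γ ≤ (7/5)A₀` (`A₀ < 345902`; the card's design band is `γ = λA₀`, `λ ∈ [0.34, 1]`),
`‖u(P)‖² ≥ (316/125)(A₁ − (7/5)A₀) > 1.906·10⁶ > Y₀² (Y₀ < 1351.2)`: the configuration «level-1 Burgers child
with its strainer already on at τ₀» carries a point of speed `> Y₀`, which the GLOBAL ANCHOR forbids at `τ₀`
(`Stage.norm_τ_zero_le`: `‖u(τ₀, x)‖ ≤ c₁Y₀ = Y₀` everywhere). §4 states this by name for registered stages: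
`Stage.ne_burgersVortex_at_anchor`. For levels `k ≥ 1` the same floor `1.59√A_{k+1}` sits BELOW the running cap
`(5/3)Y_k` (card (1): `N_k^{−0.07} ≤ 1.09`), so the identity binds the BASE episode only — consistent with the
holder census TIMING LAW (19179 evidence #60 §5(b)/§1): the level-0→1 strain must be made INSIDE the window.

References: P. G. Saffman, *Vortex Dynamics* (1992) §13.3 (9), (12) [cite: Saffman1992, §13.3 eqs. (9), (12)];
S. Palasek, arXiv:2605.13827 §3.3 [cite: Palasek2026ElementaryModel, §3.3].
-/

noncomputable section

namespace Summit.NavierStokesRegularity.FluidComputer.PalasekTowerClayBridge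

open Set MeasureTheory Filter Topology Function WithLp
open scoped ENNReal ContDiff NNReal InnerProductSpace RealInnerProductSpace
open Literature.Analysis.FluidPDE

namespace BurgersOneShot

open TowerRates

/-! ## §1 The probe point `P = (2δ, 0, 0)` -/

/-- The probe point `P(γ, ν) = (2δ, 0, 0)`, `δ = (ν/γ)^{1/2}` the Burgers core radius: twice the core radius
from the axis, in the symmetry plane `x₂ = 0`. [cite: Saffman1992, §13.3 eq. (12)] -/
def twoCorePoint (γ ν : ℝ) : EuclideanSpace ℝ (Fin 3) :=
  toLp 2 ![2 * Real.sqrt (ν / γ), 0, 0]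

/-- Components of the probe point. [folklore] -/
@[simp] theorem twoCorePoint_apply_zero (γ ν : ℝ) : twoCorePoint γ ν 0 = 2 * Real.sqrt (ν / γ) := rfl

/-- Components of the probe point. [folklore] -/
@[simp] theorem twoCorePoint_apply_one (γ ν : ℝ) : twoCorePoint γ ν 1 = 0 := rfl

/-- Components of the probe point. [folklore] -/
@[simp] theorem twoCorePoint_apply_two (γ ν : ℝ) : twoCorePoint γ ν 2 = 0 := rfl

/-- `P₀² + P₁² = 4ν/γ` (so the profile variable `γ r²/(4ν)` equals `1` at `P`). [folklore] -/
theorem twoCorePoint_sq {γ ν : ℝ} (hγ : 0 < γ) (hν : 0 < ν) :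
    twoCorePoint γ ν 0 ^ 2 + twoCorePoint γ ν 1 ^ 2 = 4 * ν / γ := by
  simp only [twoCorePoint_apply_zero, twoCorePoint_apply_one]
  rw [mul_pow, Real.sq_sqrt (div_pos hν hγ).le]
  ring

/-- `‖P‖ = 2δ = 2 (ν/γ)^{1/2}`. [folklore] -/
theorem norm_twoCorePoint {γ ν : ℝ} (hγ : 0 < γ) (hν : 0 < ν) :
    ‖twoCorePoint γ ν‖ = 2 * Real.sqrt (ν / γ) := by
  have h0 : 0 ≤ 2 * Real.sqrt (ν / γ) := by positivity
  rw [← sq_eq_sq₀ (norm_nonneg _) h0, EuclideanSpace.norm_sq_eq, Fin.sum_univ_three]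
  simp only [Real.norm_eq_abs, sq_abs, twoCorePoint_apply_zero, twoCorePoint_apply_one,
    twoCorePoint_apply_two]
  have := hγ; have := hν
  ring

/-! ## §2 The exact speed of the Burgers vortex at `P` -/

/-- The components of the Burgers vortex at the probe point: `u(P) = (−γδ·1, (1 − e^{−1})·c·2δ, 0)` with
`c = γΓ/(8πν)`, written as `u(P)₀ = −(γ/2)·P₀`, `u(P)₁ = c(1 − e^{−1})·P₀`, `u(P)₂ = 0`. [cite: Saffman1992, §13.3 eqs. (9), (12)] -/
theorem burgersVortex_twoCorePoint_apply {γ ν : ℝ} (hγ : 0 < γ) (hν : 0 < ν) (Γ : ℝ) :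
    burgersVortex γ ν Γ (twoCorePoint γ ν) 0 = -(γ / 2) * (2 * Real.sqrt (ν / γ)) ∧
    burgersVortex γ ν Γ (twoCorePoint γ ν) 1 =
      γ * Γ / (8 * Real.pi * ν) * (1 - Real.exp (-1)) * (2 * Real.sqrt (ν / γ)) ∧
    burgersVortex γ ν Γ (twoCorePoint γ ν) 2 = 0 := by
  have ht : γ * (twoCorePoint γ ν 0 ^ 2 + twoCorePoint γ ν 1 ^ 2) / (4 * ν) = 1 := by
    rw [twoCorePoint_sq hγ hν]; field_simp
  have hφ : burgersPhi 1 = 1 - Real.exp (-1) := by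
    have := mul_burgersPhi 1; rwa [one_mul] at this
  refine ⟨?_, ?_, ?_⟩
  · simp only [burgersVortex, Pi.add_apply, PiLp.add_apply, axisymmetricStrain, linearStrain_apply_zero,
      burgersVortexSwirl, PiLp.smul_apply, smul_eq_mul, rotGen_apply_zero, twoCorePoint_apply_one, neg_zero,
      mul_zero, add_zero, twoCorePoint_apply_zero]
    ring
  · have ht' : γ * ((2 * Real.sqrt (ν / γ)) ^ 2 + (0:ℝ) ^ 2) / (4 * ν) = 1 := by
      rw [mul_pow, Real.sq_sqrt (div_pos hν hγ).le]; field_simp; ring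
    simp only [burgersVortex, Pi.add_apply, PiLp.add_apply, axisymmetricStrain, linearStrain_apply_one,
      burgersVortexSwirl, PiLp.smul_apply, smul_eq_mul, rotGen_apply_one, twoCorePoint_apply_one,
      twoCorePoint_apply_zero, mul_zero, zero_add]
    rw [ht', hφ]
  · simp only [burgersVortex, Pi.add_apply, PiLp.add_apply, axisymmetricStrain, linearStrain_apply_two,
      burgersVortexSwirl, PiLp.smul_apply, smul_eq_mul, rotGen_apply_two, twoCorePoint_apply_two, mul_zero,
      add_zero]

/-- **The exact squared speed of the Burgers vortex at `P = (2δ, 0, 0)`**: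
`‖u(P)‖² = γν + (1 − e^{−1})² · Γ²γ/(16π²ν)` (radial strain speed `γδ` ⊥ azimuthal swirl speed
`(1 − e^{−1})|Γ|(γ/ν)^{1/2}/(4π)`). [cite: Saffman1992, §13.3 eqs. (9), (12)] -/
theorem norm_sq_burgersVortex_twoCorePoint {γ ν : ℝ} (hγ : 0 < γ) (hν : 0 < ν) (Γ : ℝ) :
    ‖burgersVortex γ ν Γ (twoCorePoint γ ν)‖ ^ 2 =
      γ * ν + (1 - Real.exp (-1)) ^ 2 * (Γ ^ 2 * γ / (16 * Real.pi ^ 2 * ν)) := by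
  obtain ⟨h0, h1, h2⟩ := burgersVortex_twoCorePoint_apply hγ hν Γ
  rw [EuclideanSpace.norm_sq_eq, Fin.sum_univ_three]
  simp only [Real.norm_eq_abs, sq_abs]
  rw [h0, h1, h2]
  have hs : Real.sqrt (ν / γ) ^ 2 = ν / γ := Real.sq_sqrt (div_pos hν hγ).le
  have hπ : Real.pi ≠ 0 := Real.pi_ne_zero
  field_simp
  rw [hs]
  field_simp
  ring

/-! ## §3 The one-shot floor -/

/-- **THE ONE-SHOT BUDGET IDENTITY, field form** (AM–GM on the two orthogonal speeds at `P`):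
`(1 − e^{−1}) γ|Γ|/(2π) ≤ ‖u(P)‖²` for the Burgers vortex with strain `γ > 0`, viscosity `ν > 0` and
circulation `Γ`. [cite: Saffman1992, §13.3 eqs. (9), (12)] -/
theorem oneShot_norm_sq_ge {γ ν : ℝ} (hγ : 0 < γ) (hν : 0 < ν) (Γ : ℝ) :
    (1 - Real.exp (-1)) * (γ * |Γ|) / (2 * Real.pi) ≤ ‖burgersVortex γ ν Γ (twoCorePoint γ ν)‖ ^ 2 := by
  rw [norm_sq_burgersVortex_twoCorePoint hγ hν Γ]
  have hπ := Real.pi_pos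
  have he : 0 ≤ 1 - Real.exp (-1 : ℝ) := by
    rw [sub_nonneg, Real.exp_le_one_iff]; norm_num
  -- AM–GM in the form `(a - b)² ≥ 0` with `a = (γν)^{1/2}·(4π)`, `b = (1 - e⁻¹)|Γ|(γ/ν)^{1/2}`… done with squares only:
  -- `γν + K² ≥ 2 (γν)^{1/2} K` where `K = (1 - e⁻¹)|Γ|(γ/ν)^{1/2}/(4π)` and `(γν)^{1/2}(γ/ν)^{1/2} = γ`.
  set e := 1 - Real.exp (-1 : ℝ) with he_def
  have hΓ2 : Γ ^ 2 = |Γ| ^ 2 := (sq_abs Γ).symm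
  rw [hΓ2]
  -- reduce to a polynomial inequality in `s := (γν)^{1/2}` … avoid square roots: multiply through by `16π²ν > 0`
  rw [div_le_iff₀ (by positivity : (0 : ℝ) < 2 * Real.pi)]
  have expand : (γ * ν + e ^ 2 * (|Γ| ^ 2 * γ / (16 * Real.pi ^ 2 * ν))) * (2 * Real.pi) - e * (γ * |Γ|) =
      (4 * Real.pi * ν - e * |Γ|) ^ 2 * γ / (8 * Real.pi * ν) := by
    field_simp
    ring
  have hdiv : 0 ≤ (4 * Real.pi * ν - e * |Γ|) ^ 2 * γ / (8 * Real.pi * ν) := by positivity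
  linarith

/-- **THE ONE-SHOT BUDGET IDENTITY, gradient form**: if the Burgers vortex meets an axis-gradient floor
`A ≤ ‖Du(0)‖`, then `4(1 − e^{−1}) ν (A − γ) ≤ ‖u(P)‖²` — because `‖Du(0)‖ ≤ γ + γ|Γ|/(8πν)`
(strain rate plus core rotation rate, `norm_fderiv_burgersVortex_le_sharp`), so `γ|Γ| ≥ 8πν(A − γ)`.
[cite: Saffman1992, §13.3 eqs. (9), (12)] -/
theorem oneShot_norm_sq_ge_of_axisGradient {γ ν A : ℝ} (hγ : 0 < γ) (hν : 0 < ν) (Γ : ℝ)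
    (hA : A ≤ ‖fderiv ℝ (burgersVortex γ ν Γ) 0‖) :
    4 * (1 - Real.exp (-1)) * ν * (A - γ) ≤ ‖burgersVortex γ ν Γ (twoCorePoint γ ν)‖ ^ 2 := by
  have h1 := oneShot_norm_sq_ge hγ hν Γ
  have h2 := (norm_fderiv_burgersVortex_le_sharp hγ hν Γ 0).2
  have hπ := Real.pi_pos
  have he : 0 ≤ 1 - Real.exp (-1 : ℝ) := by
    rw [sub_nonneg, Real.exp_le_one_iff]; norm_num
  rw [abs_of_pos hγ, abs_div, abs_mul, abs_of_pos hγ, abs_of_pos (by positivity : 0 < 8 * Real.pi * ν)] at h2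
  -- `A ≤ γ + γ|Γ|/(8πν)` ⇒ `8πν(A - γ) ≤ γ|Γ|`
  have h3 : 8 * Real.pi * ν * (A - γ) ≤ γ * |Γ| := by
    have := hA.trans h2
    have h8 : 0 < 8 * Real.pi * ν := by positivity
    rw [← sub_le_iff_le_add', le_div_iff₀ h8] at this
    linarith
  -- multiply by `(1 - e⁻¹)/(2π) ≥ 0`
  have h4 : (1 - Real.exp (-1)) * (8 * Real.pi * ν * (A - γ)) / (2 * Real.pi) ≤
      (1 - Real.exp (-1)) * (γ * |Γ|) / (2 * Real.pi) :=
    div_le_div_of_nonneg_right (mul_le_mul_of_nonneg_left h3 he) (by positivity)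
  have h5 : (1 - Real.exp (-1)) * (8 * Real.pi * ν * (A - γ)) / (2 * Real.pi) =
      4 * (1 - Real.exp (-1)) * ν * (A - γ) := by
    field_simp
    ring
  linarith

/-- `1 − e^{−1} ≥ 79/125 = 0.632`. [folklore] -/
theorem one_sub_exp_neg_one_ge : (79 : ℝ) / 125 ≤ 1 - Real.exp (-1) := by
  have he := Real.exp_one_gt_d9
  have hpos := Real.exp_pos (1 : ℝ)
  rw [Real.exp_neg]
  have : (Real.exp 1)⁻¹ ≤ 46 / 125 := by
    rw [inv_le_comm₀ hpos (by norm_num)]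
    linarith
  linarith

/-- **Rational form**: under an axis-gradient floor `A ≤ ‖Du(0)‖` with `γ ≤ A`,
`(316/125) ν (A − γ) ≤ ‖u(P)‖²`, i.e. `‖u(P)‖ ≥ 1.59 (ν(A − γ))^{1/2}` (the card's `1.60√A`). [folklore] -/
theorem oneShot_norm_sq_ge_rational {γ ν A : ℝ} (hγ : 0 < γ) (hν : 0 < ν) (Γ : ℝ)
    (hA : A ≤ ‖fderiv ℝ (burgersVortex γ ν Γ) 0‖) (hγA : γ ≤ A) :
    (316 : ℝ) / 125 * ν * (A - γ) ≤ ‖burgersVortex γ ν Γ (twoCorePoint γ ν)‖ ^ 2 := by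
  have h1 := oneShot_norm_sq_ge_of_axisGradient hγ hν Γ hA
  have h2 := one_sub_exp_neg_one_ge
  have h3 : 0 ≤ ν * (A - γ) := mul_nonneg hν.le (by linarith)
  nlinarith

/-! ## §4 Register reading (wide rates, `ν = 1`): the base episode cannot hand over in one shot -/

/-- **The register number**: `Y₀² < (316/125)(A₁ − (7/5)A₀)` for the wide rates
(`1351.2² = 1825741.44 < 2.528 · (1238360 − 1.4 · 345902) = 1906356.5…`). [cite: Palasek2026ElementaryModel, §3.3] -/
theorem wide_Y_zero_sq_lt_oneShot_budget :
    wide.Y 0 ^ 2 < (316 : ℝ) / 125 * (wide.A 1 - 7 / 5 * wide.A 0) := by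
  obtain ⟨-, hY⟩ := UniversalFace.wide_Y_zero_bounds_fine
  obtain ⟨hA1, -⟩ := wide_A_one_bounds
  obtain ⟨-, hA0⟩ := wide_A_zero_bounds
  have hY0 : 0 < wide.Y 0 := lt_trans (by norm_num) UniversalFace.wide_Y_zero_bounds_fine.1
  have hsq : wide.Y 0 ^ 2 < (1351.2 : ℝ) ^ 2 := by nlinarith
  nlinarith

/-- **ONE-SHOT HAND-OVER IS OVER BUDGET AT LEVEL 0** (wide rates, `ν = 1`): a Burgers vortex whose axis
gradient meets the level-1 strain floor `A₁ ≤ ‖Du(0)‖` while its strain rate is at most `(7/5)A₀` (every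
design point `γ = λA₀`, `λ ≤ 1.4`, of the S⋆ brief) has speed `> Y₀` at the probe point `P = (2γ^{−1/2}, 0, 0)`.
[cite: Palasek2026ElementaryModel, §3.3] -/
theorem oneShot_speed_gt_Y_zero {γ Γ : ℝ} (hγ : 0 < γ) (hγA : γ ≤ 7 / 5 * wide.A 0)
    (hA : wide.A 1 ≤ ‖fderiv ℝ (burgersVortex γ 1 Γ) 0‖) :
    wide.Y 0 < ‖burgersVortex γ 1 Γ (twoCorePoint γ 1)‖ := by
  obtain ⟨hA1, -⟩ := wide_A_one_bounds
  obtain ⟨-, hA0u⟩ := wide_A_zero_bounds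
  have hγA' : γ ≤ wide.A 1 := by linarith
  have h1 := oneShot_norm_sq_ge_rational hγ one_pos Γ hA hγA'
  have h2 := wide_Y_zero_sq_lt_oneShot_budget
  have hY0 : 0 < wide.Y 0 := lt_trans (by norm_num) UniversalFace.wide_Y_zero_bounds_fine.1
  have h3 : wide.Y 0 ^ 2 < ‖burgersVortex γ 1 Γ (twoCorePoint γ 1)‖ ^ 2 := by nlinarith
  exact lt_of_pow_lt_pow_left₀ 2 (norm_nonneg _) h3

/-- The probe point lies within `2 γ^{−1/2} ≤ 2 A₀^{−1/2}`-scale of the axis — for `γ ≥ A₀/3` within `1/339` of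
the child's axis point, far inside any tower ball: `‖P‖ = 2/√γ`. [folklore] -/
theorem norm_twoCorePoint_one {γ : ℝ} (hγ : 0 < γ) : ‖twoCorePoint γ 1‖ = 2 * Real.sqrt (1 / γ) :=
  norm_twoCorePoint hγ one_pos

/-- **BY NAME, for registered stages of the route's register** (`Margins.routeG`, wide rates, `ν = 1`): the
`τ₀`-slice of a registered stage cannot AGREE, at the single point `x₀ + P`, with a translated Burgers vortex
whose axis gradient meets the level-1 strain floor in a host strain `γ ≤ (7/5)A₀` — the GLOBAL ANCHOR caps every
speed at `τ₀` by `c₁Y₀ = Y₀` (`Stage.norm_τ_zero_le`, `Rigid.c₁_eq`), the model point carries more. So a design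
whose level-1 child AND its strainer are both «already there» at the anchor is not a registered stage: the base
episode must make its strain inside the window. [cite: Palasek2026ElementaryModel, §3.3] -/
theorem Stage.ne_burgersVortex_at_anchor {S : Schedule wide} {k : ℕ}
    (s : Stage 1 wide S (Margins.routeG wide) k) (x₀ : EuclideanSpace ℝ (Fin 3)) {γ Γ : ℝ}
    (hγ : 0 < γ) (hγA : γ ≤ 7 / 5 * wide.A 0) (hA : wide.A 1 ≤ ‖fderiv ℝ (burgersVortex γ 1 Γ) 0‖) :
    s.u (S.τ 0) (x₀ + twoCorePoint γ 1) ≠ burgersVortex γ 1 Γ (twoCorePoint γ 1) := by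
  intro h
  have h1 := s.norm_τ_zero_le (x₀ + twoCorePoint γ 1)
  rw [s.routeG_rigid.c₁_eq, one_mul, h] at h1
  exact absurd h1 (not_le.2 (oneShot_speed_gt_Y_zero hγ hγA hA))

/-- Corollary in the card's words: no registered stage's `τ₀`-slice restricts, on any set containing `x₀ + P`,
to the translate `x ↦ u_B(x − x₀)` of such a Burgers vortex. [cite: Palasek2026ElementaryModel, §3.3] -/
theorem Stage.not_eqOn_burgersVortex_at_anchor {S : Schedule wide} {k : ℕ}
    (s : Stage 1 wide S (Margins.routeG wide) k) (x₀ : EuclideanSpace ℝ (Fin 3)) {γ Γ : ℝ}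
    (hγ : 0 < γ) (hγA : γ ≤ 7 / 5 * wide.A 0) (hA : wide.A 1 ≤ ‖fderiv ℝ (burgersVortex γ 1 Γ) 0‖)
    {D : Set (EuclideanSpace ℝ (Fin 3))} (hD : x₀ + twoCorePoint γ 1 ∈ D) :
    ¬ EqOn (s.u (S.τ 0)) (fun x => burgersVortex γ 1 Γ (x - x₀)) D := by
  intro h
  have := h hD
  simp only [add_sub_cancel_left] at this
  exact Stage.ne_burgersVortex_at_anchor s x₀ hγ hγA hA this

end BurgersOneShot

end Summit.NavierStokesRegularity.FluidComputer.PalasekTowerClayBridge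

end
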